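import Summits.Langlands.Langlands.Theorems.SqrtFiveQuarticCoversCertB3E7GroupLaw
import Summits.Langlands.Langlands.Theorems.SqrtFiveQuarticCoversCertB3E7MordellWeil
import Summits.Langlands.Langlands.Theorems.SqrtFiveQuarticCoversCertB3E7ZDS
import Summits.Langlands.Langlands.Theorems.SqrtFiveQuarticCoversCertS3H12AnchorsNonSquare

/-!
# Route `Langlands/SqrtFiveQuarticCovers`, certificate `CertB3E7` (sheet 4.5 `X(b3,H12,e7)`;
# stmt-Langlands-23416) — the Mordell–Weil input of row 8 PUSHED UPSTREAM TO `ℚ`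

In `Theorems/SqrtFiveQuarticCoversCertB3E7GroupLaw.lean` (p674866, typ-1) the registered stub
`MordellWeilE7` (= `hE49` of `certB3E7`) is derived from the named input

* `hMW` «`W(K)^σ = {O, T}`»: for `K` quartic, `r² = 5`, `σ : K →+* K` with `σ r = r`, `σ ≠ id`, every
  `σ`-fixed affine `K`-point of `W : Y² = X³ + 294X² − 343X` is `T = (0,0)` — i.e. the certified
  datum «`49a4(ℚ(√5)) ≅ ℤ/2`» (`W ≅_ℚ 49a4`), rank `0` over `ℚ(√5)` via exact `L`-values
  (`L(49a,1)·L(49a⊗χ₅,1) ≠ 0`, certnum RELEASES l.140) + Kolyvagin–Logachev (named print).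

This file proves that `hMW` is **equivalent in the kernel** to the conjunction of two statements
about RATIONAL points of two elliptic curves over `ℚ`:

* `hQ`  «`∀ X Y : ℚ, Y² = X³ + 294X² − 343X → X = 0`» — the affine `ℚ`-points of `W` are `{T}`,
  i.e. `W(ℚ) = {O, T} ≅ ℤ/2`.  `W` is Cremona's **`49a4`** `= [1, −1, 0, −1822, 30393]`
  (`(u,r,s,t) = (2, −99, 1, 0)`, anchor `e7_W_variableChange_49a4` of the GroupLaw file): conductor
  `49`, rank `0`, torsion `ℤ/2` generated by `(99/4, −99/8)` [Cremona 1997, Table 1, `N = 49`,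
  curve A4: `r = 0`, `|T| = 2` — PRINT; = LMFDB `49.a1` by the same conventions, j320107]; replayed by PARI 2.17 `ellrank` =
  `[0, 0, 0, []]` (2-descent: rank upper bound `0`), `elltors` = `[2]`, `ellanalyticrank` = `0`,
  `L(W,1) = 0.96665…`, `L(1)/BSD-quotient = 1.000…` (kit job j319940, `e7q.gp`).
* `hQ5` «`∀ X Y : ℚ, Y² = X³ + 1470X² − 8575X → X = 0`» — the same for the QUADRATIC TWIST
  `W⁵ = W ⊗ χ₅ : Y² = X³ + 5·294X² − 25·343X`; minimal model `[1, −1, 1, −45555, 3753572]`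
  (`(u,r,s,t) = (2, −491, 1, 4)`, anchor `e7_W5_variableChange`), conductor `1225 = 5²·7²`, rank `0`,
  torsion `ℤ/2` generated by `(491/4, −495/8)`.  SOURCE KIND = DATABASE, not print: conductor
  `1225 > 1000` is NOT in Cremona's printed Table 1; the curve is in Cremona's electronic database /
  the LMFDB — label **`1225.c1`** by the LMFDB ordering conventions (isogeny classes of conductor `1225`
  sorted lexicographically by `(a_p)_p` among the `10` rational newforms of level `1225`; curves in the
  class `{[1,−1,1,−45555,3753572], [1,−1,1,−2680,66322], [1,−1,1,−930,−10678], [1,−1,1,−55,−178]}`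
  sorted by minimal `a`-invariants; computed from first principles by PARI `mfinit/mfsplit/ellisomat`,
  kit j320107 — no database access inside the cell; Cremona's historical letter for `N = 1225` may
  differ), where rank `0` and torsion `ℤ/2` are mwrank 2-descent facts; replayed
  here by PARI 2.17: `ellrank` = `[0, 0, 0, []]` (2-descent rank upper bound `0`), `elltors` = `[2]`,
  `ellanalyticrank` = `0`, `L(W⁵,1) = 0.86460…` (this is the factor `L(49a ⊗ χ₅, 1) ≠ 0` of certnum
  l.140 K1), `L(1)/BSD-quotient = 1.000…` [kit j319940, j320107].

ARGUMENT (`e7W_ratSpan_point`; elementary CHORD ALGEBRA — no group law, no automorphism, no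
Galois theory beyond `K^σ = ℚ + ℚ·r`, eng-8 g2's `ringHom_fixing_sqrt_five_sq_eq_id`).  A `σ`-fixed
point is `(X, Y) = (u + v·r, s + t·r)` with `u v s t : ℚ`; the curve equation splits along the
`ℚ`-basis `{1, r}` (`ratCast_add_ratCast_mul_eq_zero`) into `A = 0`, `B = 0` (`e7W_ratSpan_split`).
If `v = 0` then `st = 0` and either `(u, s) ∈ W(ℚ)` or `(5u, 25t) ∈ W⁵(ℚ)`, so `u = 0` by `hQ`/`hQ5`.
If `v ≠ 0`: the chord through `P = (u + vr, s + tr)` and its conjugate `P̄ = (u − vr, s − tr)` has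
the RATIONAL slope `t/v`, so its third intersection with `W` is an explicit rational point
`(x_S, y_S)`, `x_S = t²/v² − 294 − 2u` (Vieta; the on-curve identity `e7W_chord_sum` is
`field_simp; ring`) ⇒ `x_S = 0` by `hQ`; the chord through `P` and `−P̄` is `Y = r·(mX + c₀)` with
`m = s/(5v)`, `c₀ = t − su/(5v)` RATIONAL, third intersection `(x_D, r·w)` with
`x_D = s²/(5v²) − 294 − 2u`, `5w² = f(x_D)` (`e7W_chord_diff`) ⇒ `(5x_D, 25w) ∈ W⁵(ℚ)` ⇒ `x_D = 0` by
`hQ5`; hence `s² = 5t²`, so `s = t = 0` (`√5 ∉ ℚ`), `Y = 0`, `X² + 294X − 343 = 0` with `X ∉ ℚ`,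
forcing `u = −147` and `5v² = 21952 = 2⁶·7³`, i.e. `(5v/56)² = 35` — impossible
(`not_isSquare_rat_thirtyFive`).  So `v ≠ 0` never happens and `X = Y = 0`.
CONVERSELY (`ratPoints_of_fixedPointsW`) `hMW ⇒ hQ ∧ hQ5`: instantiate `hMW` at the quartic field
`K = ℚ(ζ₅) ∋ r = 1 + 2(ζ₅ + ζ₅⁴)` (`r² = 5`) with `σ =` the nontrivial automorphism over `ℚ(r)`
(`exists_ringHom_ne_id_fixing_sqrt_five`), at the `σ`-fixed points `(X, Y)` resp. `(X/5, Y·r/25)`.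

MAIN DECLARATIONS
* `fixedPointsW_of_ratPoints (hQ) (hQ5) : «hMW»` and `ratPoints_of_fixedPointsW (hMW) : hQ ∧ hQ5`
  — `hMW ⟺ hQ ∧ hQ5` KERNEL-EQUIVALENT;
* `mordellWeilE7_of_ratPoints (hQ) (hQ5) :` the registered stub type `MordellWeilE7` VERBATIM
  (via typ-1's `mordellWeilE7_of_fixedPoints`, p674866);
* `certB3E7_of_modelIdentificationInf_of_ratPoints (hK1inf) (hQ) (hQ5) : …Theses…CertB3E7` BY NAME
  (via eng-7 g4's `certB3E7_of_modelIdentificationInf_of_mordellWeil`, p675221): sheet 4.5 rests on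
  {`ModelIdentificationB3E7Inf`, `hQ`, `hQ5`} — one model identification and TWO LINES OF
  CREMONA'S TABLES over `ℚ` (each with two independent published proofs: 2-descent à la
  mwrank/`ellrank`, and `L(E,1) ≠ 0` + Kolyvagin/Gross–Zagier over `ℚ`);
* anchors `e7_W5_variableChange` (`W⁵ ↦ [1,−1,1,−45555,3753572]`, `T ↦ (491/4, −495/8)`) and
  `e7_W_W5_torsionPoints` (the torsion generators lie on the minimal models).

HONEST STATUS: CONDITIONAL bookkeeping; the two rank-`0` facts over `ℚ` stay NAMED inputs (printed /
database theorems about two explicit elliptic curves over `ℚ`, not proved here: Mathlib has no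
Mordell–Weil theorem and no descent); a certified finite datum is not a modularity or BSD statement;
nothing here proves modularity of any curve or of a new class of curves.  References:
[FreitasLeHungSiksek2015] Lemma 4.2 (arXiv:1310.7088 p. 28); [Cremona1997] Table 1; cell records
CENSUS.md §15 row 4.5, NAMED-INPUT-TABLE.md row 8; kit j319940.
-/

noncomputable section

set_option linter.dupNamespace false -- project-wide option; `Summit.Langlands.Langlands` is the mandated namespace

open scoped MatrixGroups NumberField Matrix Polynomial IntermediateField
open NumberField Polynomial
open Summit.Langlands.Langlands.Theses.SqrtFiveQuarticCovers

namespace Summit.Langlands.Langlands.Theorems.SqrtFiveQuarticCovers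

/-! ### §1 Two rational non-squares -/

/-- `35` is not the square of a rational number (`5² < 35 < 6²`). [folklore] -/
theorem not_isSquare_rat_thirtyFive : ¬ IsSquare (35 : ℚ) := by
  rw [Rat.isSquare_ofNat_iff]
  exact nat_not_isSquare_of_between_squares (k := 5) (by norm_num) (by norm_num)

/-- `s² = 5t²` with `s t : ℚ` forces `s = t = 0` (`5` is not a rational square). [folklore] -/
theorem eq_zero_of_sq_eq_five_mul_sq {s t : ℚ} (h : s ^ 2 = 5 * t ^ 2) : s = 0 ∧ t = 0 := by
  by_cases ht : t = 0
  · subst ht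
    have hs : s ^ 2 = 0 := by rw [h]; ring
    exact ⟨pow_eq_zero_iff two_ne_zero |>.1 hs, rfl⟩
  · exfalso
    apply not_isSquare_rat_five_and_norms.1
    refine ⟨s / t, ?_⟩
    field_simp
    linear_combination -h

/-! ### §2 The `{1, r}`-split of the Weierstrass equation of `W` at a point of `ℚ + ℚ·r` -/

/-- **Split of `Y² = X³ + 294X² − 343X` at `(X, Y) = (u + v·r, s + t·r)`** (`u v s t : ℚ`, `r² = 5`,
characteristic `0`): the rational part `A` and the `r`-part `B` of `Y² − f(X)` both vanish, where
`A = s² + 5t² − (u³ + 15uv² + 294u² + 1470v² − 343u)` and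
`B = 2st − (3u²v + 5v³ + 588uv − 343v)`. [folklore] -/
theorem e7W_ratSpan_split {K : Type} [Field K] [CharZero K] {r : K} (hr : r ^ 2 = 5)
    {u v s t : ℚ}
    (h : ((s : K) + (t : K) * r) ^ 2 =
      ((u : K) + (v : K) * r) ^ 3 + 294 * ((u : K) + (v : K) * r) ^ 2 - 343 * ((u : K) + (v : K) * r)) :
    s ^ 2 + 5 * t ^ 2 - (u ^ 3 + 15 * u * v ^ 2 + 294 * u ^ 2 + 1470 * v ^ 2 - 343 * u) = 0 ∧
    2 * s * t - (3 * u ^ 2 * v + 5 * v ^ 3 + 588 * u * v - 343 * v) = 0 := by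
  have h0 : ((s ^ 2 + 5 * t ^ 2 - (u ^ 3 + 15 * u * v ^ 2 + 294 * u ^ 2 + 1470 * v ^ 2 - 343 * u) : ℚ) : K)
      + ((2 * s * t - (3 * u ^ 2 * v + 5 * v ^ 3 + 588 * u * v - 343 * v) : ℚ) : K) * r = 0 := by
    push_cast
    linear_combination h - ((t : K) ^ 2 - 3 * (u : K) * (v : K) ^ 2 - (v : K) ^ 3 * r
      - 294 * (v : K) ^ 2) * hr
  exact ratCast_add_ratCast_mul_eq_zero hr h0

/-! ### §3 The two chords (Vieta identities over `ℚ`) -/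

/-- **Sum chord.**  With `λ = t/v`, `x_S = λ² − 294 − 2u`, `y_S = λ(u − x_S) − s` (the third
intersection of `W` with the line of RATIONAL slope `t/v` through `(u ± v r, s ± t r)`):
`y_S² − f(x_S) = A + (B/v)(x_S − u)` identically (`A`, `B` as in `e7W_ratSpan_split`). [folklore] -/
theorem e7W_chord_sum (u v s t : ℚ) (hv : v ≠ 0) :
    (t / v * (u - (t ^ 2 / v ^ 2 - 294 - 2 * u)) - s) ^ 2
      - ((t ^ 2 / v ^ 2 - 294 - 2 * u) ^ 3 + 294 * (t ^ 2 / v ^ 2 - 294 - 2 * u) ^ 2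
          - 343 * (t ^ 2 / v ^ 2 - 294 - 2 * u)) =
      (s ^ 2 + 5 * t ^ 2 - (u ^ 3 + 15 * u * v ^ 2 + 294 * u ^ 2 + 1470 * v ^ 2 - 343 * u))
      + (2 * s * t - (3 * u ^ 2 * v + 5 * v ^ 3 + 588 * u * v - 343 * v)) / v
          * ((t ^ 2 / v ^ 2 - 294 - 2 * u) - u) := by
  field_simp
  ring

/-- **Difference chord.**  With `m = s/(5v)`, `c₀ = t − su/(5v)`, `x_D = 5m² − 294 − 2u`,
`w = m·x_D + c₀` (the third intersection of `W` with the line `Y = r·(mX + c₀)` through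
`(u + v r, s + t r)` and `(u − v r, −s + t r)` is `(x_D, r·w)`):
`5w² − f(x_D) = A + (B/v)(x_D − u)` identically. [folklore] -/
theorem e7W_chord_diff (u v s t : ℚ) (hv : v ≠ 0) :
    5 * (s / (5 * v) * (s ^ 2 / (5 * v ^ 2) - 294 - 2 * u) + (t - s * u / (5 * v))) ^ 2
      - ((s ^ 2 / (5 * v ^ 2) - 294 - 2 * u) ^ 3 + 294 * (s ^ 2 / (5 * v ^ 2) - 294 - 2 * u) ^ 2
          - 343 * (s ^ 2 / (5 * v ^ 2) - 294 - 2 * u)) =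
      (s ^ 2 + 5 * t ^ 2 - (u ^ 3 + 15 * u * v ^ 2 + 294 * u ^ 2 + 1470 * v ^ 2 - 343 * u))
      + (2 * s * t - (3 * u ^ 2 * v + 5 * v ^ 3 + 588 * u * v - 343 * v)) / v
          * ((s ^ 2 / (5 * v ^ 2) - 294 - 2 * u) - u) := by
  field_simp
  ring

/-! ### §4 Every point of `W` with coordinates in `ℚ + ℚ·r` is `T = (0, 0)`, given `W(ℚ)` and `W⁵(ℚ)` -/

/-- **Main algebraic step.**  `hQ` «affine `ℚ`-points of `W : Y² = X³ + 294X² − 343X` have `X = 0`»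
(`49a4(ℚ) ≅ ℤ/2`) and `hQ5` «affine `ℚ`-points of `W⁵ : Y² = X³ + 1470X² − 8575X` have `X = 0`»
(the `5`-twist, conductor `1225`, `≅ ℤ/2`) imply: in any field of characteristic `0` with `r² = 5`,
a point `(u + v·r, s + t·r)` of `W` (`u v s t : ℚ`) has `u = v = s = t = 0`.  Proof: the module
docstring's chord argument. [folklore] -/
theorem e7W_ratSpan_point
    (hQ : ∀ X Y : ℚ, Y ^ 2 = X ^ 3 + 294 * X ^ 2 - 343 * X → X = 0)
    (hQ5 : ∀ X Y : ℚ, Y ^ 2 = X ^ 3 + 1470 * X ^ 2 - 8575 * X → X = 0)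
    {K : Type} [Field K] [CharZero K] {r : K} (hr : r ^ 2 = 5) {u v s t : ℚ}
    (h : ((s : K) + (t : K) * r) ^ 2 =
      ((u : K) + (v : K) * r) ^ 3 + 294 * ((u : K) + (v : K) * r) ^ 2 - 343 * ((u : K) + (v : K) * r)) :
    u = 0 ∧ v = 0 ∧ s = 0 ∧ t = 0 := by
  obtain ⟨hA, hB⟩ := e7W_ratSpan_split hr h
  by_cases hv : v = 0
  · subst hv
    have hst : s * t = 0 := by linear_combination hB / 2
    rcases mul_eq_zero.1 hst with hs | ht
    · subst hs
      -- `5t² = f(u)`: `(5u, 25t) ∈ W⁵(ℚ)`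
      have h5 : (25 * t) ^ 2 = (5 * u) ^ 3 + 1470 * (5 * u) ^ 2 - 8575 * (5 * u) := by
        linear_combination 125 * hA
      have hu : u = 0 := by linear_combination hQ5 _ _ h5 / 5
      subst hu
      have ht2 : (0 : ℚ) ^ 2 = 5 * t ^ 2 := by linear_combination -hA
      exact ⟨rfl, rfl, rfl, (eq_zero_of_sq_eq_five_mul_sq ht2).2⟩
    · subst ht
      -- `s² = f(u)`: `(u, s) ∈ W(ℚ)`
      have h1 : s ^ 2 = u ^ 3 + 294 * u ^ 2 - 343 * u := by linear_combination hA
      have hu : u = 0 := hQ _ _ h1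
      subst hu
      have hs2 : s ^ 2 = 0 := by linear_combination hA
      exact ⟨rfl, rfl, pow_eq_zero_iff two_ne_zero |>.1 hs2, rfl⟩
  · exfalso
    -- the sum chord: a rational point `(x_S, y_S)` of `W`, so `x_S = 0`
    have hS : (t / v * (u - (t ^ 2 / v ^ 2 - 294 - 2 * u)) - s) ^ 2 =
        (t ^ 2 / v ^ 2 - 294 - 2 * u) ^ 3 + 294 * (t ^ 2 / v ^ 2 - 294 - 2 * u) ^ 2
          - 343 * (t ^ 2 / v ^ 2 - 294 - 2 * u) := by
      linear_combination e7W_chord_sum u v s t hv + hA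
        + ((t ^ 2 / v ^ 2 - 294 - 2 * u) - u) / v * hB
    have hxS : t ^ 2 / v ^ 2 - 294 - 2 * u = 0 := hQ _ _ hS
    -- the difference chord: a rational point `(5x_D, 25w)` of `W⁵`, so `x_D = 0`
    have hD : 5 * (s / (5 * v) * (s ^ 2 / (5 * v ^ 2) - 294 - 2 * u) + (t - s * u / (5 * v))) ^ 2 =
        (s ^ 2 / (5 * v ^ 2) - 294 - 2 * u) ^ 3 + 294 * (s ^ 2 / (5 * v ^ 2) - 294 - 2 * u) ^ 2
          - 343 * (s ^ 2 / (5 * v ^ 2) - 294 - 2 * u) := by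
      linear_combination e7W_chord_diff u v s t hv + hA
        + ((s ^ 2 / (5 * v ^ 2) - 294 - 2 * u) - u) / v * hB
    have hD' : (25 * (s / (5 * v) * (s ^ 2 / (5 * v ^ 2) - 294 - 2 * u) + (t - s * u / (5 * v)))) ^ 2 =
        (5 * (s ^ 2 / (5 * v ^ 2) - 294 - 2 * u)) ^ 3 + 1470 * (5 * (s ^ 2 / (5 * v ^ 2) - 294 - 2 * u)) ^ 2
          - 8575 * (5 * (s ^ 2 / (5 * v ^ 2) - 294 - 2 * u)) := by
      linear_combination 125 * hD
    have hxD : s ^ 2 / (5 * v ^ 2) - 294 - 2 * u = 0 := by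
      linear_combination hQ5 _ _ hD' / 5
    -- hence `t² = (294 + 2u)v²`, `s² = 5(294 + 2u)v²`, so `s² = 5t²` and `s = t = 0`
    have ht2 : t ^ 2 = (294 + 2 * u) * v ^ 2 := by
      field_simp at hxS
      linear_combination hxS
    have hs2 : s ^ 2 = 5 * ((294 + 2 * u) * v ^ 2) := by
      field_simp at hxD
      linear_combination hxD
    rw [← ht2] at hs2
    obtain ⟨hs, ht⟩ := eq_zero_of_sq_eq_five_mul_sq hs2
    subst hs ht
    -- `Y = 0`: `u = −147` from `t² = (294 + 2u)v² = 0`, then `B = 0` gives `5v² = 21952 = 2⁶·7³`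
    have hu : u = -147 := by
      have h0 : (294 + 2 * u) * v ^ 2 = 0 := by linear_combination -ht2
      have h1 : 294 + 2 * u = 0 := (mul_eq_zero.1 h0).resolve_right (pow_ne_zero 2 hv)
      linear_combination h1 / 2
    subst hu
    have hv2 : 5 * v ^ 2 = 21952 := by
      have hB' : v * (5 * v ^ 2 - 21952) = 0 := by linear_combination -hB
      have := (mul_eq_zero.1 hB').resolve_left hv
      linear_combination this
    -- `(5v/56)² = 35`: impossible
    exact not_isSquare_rat_thirtyFive ⟨5 * v / 56, by linear_combination (-5 / 3136 : ℚ) * hv2⟩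

/-! ### §5 `hMW ⟸ hQ ∧ hQ5`: the fixed-point datum over `ℚ(√5)` from the two `ℚ`-point lists -/

/-- **Row 8 upstream: `W(K)^σ = {O, T}` from `W(ℚ) = {O, T}` and `W⁵(ℚ) = {O, T}`.**  The type is
the hypothesis `hMW` of `mordellWeilE7_of_fixedPoints` (p674866) VERBATIM.  `σ`-fixed elements of the
quartic field are `a + b·r` (`ringHom_fixing_sqrt_five_sq_eq_id`), then `e7W_ratSpan_point`.  NAMED
inputs: `hQ` = Cremona `49a4(ℚ) ≅ ℤ/2`, `hQ5` = its `5`-twist (conductor `1225`) `(ℚ) ≅ ℤ/2`.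
[cite: Cremona1997, Table 1 (N = 49, curve A4: r = 0, |T| = 2)] -/
theorem fixedPointsW_of_ratPoints
    (hQ : ∀ X Y : ℚ, Y ^ 2 = X ^ 3 + 294 * X ^ 2 - 343 * X → X = 0)
    (hQ5 : ∀ X Y : ℚ, Y ^ 2 = X ^ 3 + 1470 * X ^ 2 - 8575 * X → X = 0) :
    ∀ (K : Type) [Field K] [NumberField K], Module.finrank ℚ K = 4 → ∀ r : K, r ^ 2 = 5 →
        ∀ σ : K →+* K, σ r = r → σ ≠ RingHom.id K →
          ∀ X Y : K, σ X = X → σ Y = Y → Y ^ 2 = X ^ 3 + 294 * X ^ 2 - 343 * X → X = 0 ∧ Y = 0 := by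
  intro K _ _ hd r hr σ hσr hσ X Y hX hY hW
  obtain ⟨-, hfix⟩ := ringHom_fixing_sqrt_five_sq_eq_id hd hr σ hσr hσ
  obtain ⟨u, v, rfl⟩ := hfix X hX
  obtain ⟨s, t, rfl⟩ := hfix Y hY
  obtain ⟨rfl, rfl, rfl, rfl⟩ := e7W_ratSpan_point hQ hQ5 hr hW
  simp

/-! ### §6 `hMW ⟹ hQ ∧ hQ5`: the converse, at `K = ℚ(ζ₅)` -/

section Converse

open IsCyclotomicExtension

/-- In `ℚ(ζ₅)`, `r := 1 + 2(ζ + ζ⁴)` satisfies `r² = 5` (`ζ` a primitive `5`-th root of unity: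
`1 + ζ + ζ² + ζ³ + ζ⁴ = 0`). [folklore] -/
theorem sq_eq_five_of_isPrimitiveRoot_five {K : Type} [Field K] {ζ : K} (hζ : IsPrimitiveRoot ζ 5) :
    (1 + 2 * (ζ + ζ ^ 4)) ^ 2 = 5 := by
  have h5 : ζ ^ 5 = 1 := hζ.pow_eq_one
  have hsum : 1 + ζ + ζ ^ 2 + ζ ^ 3 + ζ ^ 4 = 0 := by
    have h := hζ.geom_sum_eq_zero (by norm_num : 1 < 5)
    simpa [Finset.sum_range_succ, pow_succ] using h
  have h8 : ζ ^ 8 = ζ ^ 3 := by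
    calc ζ ^ 8 = ζ ^ 5 * ζ ^ 3 := by ring
      _ = ζ ^ 3 := by rw [h5, one_mul]
  linear_combination (4 : K) * hsum + (4 : K) * h8 + (8 : K) * h5

/-- **Converse: `hMW ⇒ hQ ∧ hQ5`.**  Instantiate the fixed-point datum at the quartic field
`K = ℚ(ζ₅)` (`[K:ℚ] = φ(5) = 4`), `r = 1 + 2(ζ₅ + ζ₅⁴)`, and the nontrivial ring endomorphism `σ`
fixing `r` (`exists_ringHom_ne_id_fixing_sqrt_five`, p670569): a rational point `(X, Y)` of `W` is
`σ`-fixed, and a rational point `(X, Y)` of `W⁵` gives the `σ`-fixed point `(X/5, Y·r/25)` of `W`.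
So the two `ℚ`-inputs are EXACTLY as strong as `hMW` (kernel-equivalent). [folklore] -/
theorem ratPoints_of_fixedPointsW
    (hMW : ∀ (K : Type) [Field K] [NumberField K], Module.finrank ℚ K = 4 → ∀ r : K, r ^ 2 = 5 →
        ∀ σ : K →+* K, σ r = r → σ ≠ RingHom.id K →
          ∀ X Y : K, σ X = X → σ Y = Y → Y ^ 2 = X ^ 3 + 294 * X ^ 2 - 343 * X → X = 0 ∧ Y = 0) :
    (∀ X Y : ℚ, Y ^ 2 = X ^ 3 + 294 * X ^ 2 - 343 * X → X = 0) ∧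
    (∀ X Y : ℚ, Y ^ 2 = X ^ 3 + 1470 * X ^ 2 - 8575 * X → X = 0) := by
  classical
  -- the quartic field `K = ℚ(ζ₅)`
  haveI hI : IsCyclotomicExtension {5} ℚ (CyclotomicField 5 ℚ) :=
    CyclotomicField.isCyclotomicExtension 5 ℚ
  have hζ : IsPrimitiveRoot (IsCyclotomicExtension.zeta 5 ℚ (CyclotomicField 5 ℚ)) 5 :=
    IsCyclotomicExtension.zeta_spec 5 ℚ (CyclotomicField 5 ℚ)
  have hd : Module.finrank ℚ (CyclotomicField 5 ℚ) = 4 := by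
    rw [IsCyclotomicExtension.finrank (n := 5) (CyclotomicField 5 ℚ)
      (Polynomial.cyclotomic.irreducible_rat (by norm_num))]
    decide
  set r : CyclotomicField 5 ℚ := 1 + 2 * (IsCyclotomicExtension.zeta 5 ℚ (CyclotomicField 5 ℚ)
      + IsCyclotomicExtension.zeta 5 ℚ (CyclotomicField 5 ℚ) ^ 4) with hrdef
  have hr : r ^ 2 = 5 := sq_eq_five_of_isPrimitiveRoot_five hζ
  obtain ⟨σ, hσr, hσ, -⟩ := exists_ringHom_ne_id_fixing_sqrt_five hd hr
  refine ⟨fun X Y h => ?_, fun X Y h => ?_⟩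
  · have hfixX : σ (X : CyclotomicField 5 ℚ) = X := map_ratCast σ X
    have hfixY : σ (Y : CyclotomicField 5 ℚ) = Y := map_ratCast σ Y
    have hWK : (Y : CyclotomicField 5 ℚ) ^ 2 =
        (X : CyclotomicField 5 ℚ) ^ 3 + 294 * (X : CyclotomicField 5 ℚ) ^ 2
          - 343 * (X : CyclotomicField 5 ℚ) := by
      exact_mod_cast h
    have h0 := (hMW (CyclotomicField 5 ℚ) hd r hr σ hσr hσ X Y hfixX hfixY hWK).1
    exact_mod_cast h0
  · have hfixX : σ ((X / 5 : ℚ) : CyclotomicField 5 ℚ) = ((X / 5 : ℚ) : CyclotomicField 5 ℚ) :=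
      map_ratCast σ _
    have hfixY : σ (((Y / 25 : ℚ) : CyclotomicField 5 ℚ) * r) = ((Y / 25 : ℚ) : CyclotomicField 5 ℚ) * r := by
      rw [map_mul, map_ratCast, hσr]
    have hWK : (((Y / 25 : ℚ) : CyclotomicField 5 ℚ) * r) ^ 2 =
        ((X / 5 : ℚ) : CyclotomicField 5 ℚ) ^ 3 + 294 * ((X / 5 : ℚ) : CyclotomicField 5 ℚ) ^ 2
          - 343 * ((X / 5 : ℚ) : CyclotomicField 5 ℚ) := by
      have hK : ((Y ^ 2 : ℚ) : CyclotomicField 5 ℚ) =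
          ((X ^ 3 + 1470 * X ^ 2 - 8575 * X : ℚ) : CyclotomicField 5 ℚ) := by rw [h]
      push_cast at hK ⊢
      linear_combination (1 / 125 : CyclotomicField 5 ℚ) * hK
        + ((Y : CyclotomicField 5 ℚ) / 25) ^ 2 * hr
    have h0 := (hMW (CyclotomicField 5 ℚ) hd r hr σ hσr hσ _ _ hfixX hfixY hWK).1
    have : (X / 5 : ℚ) = 0 := by exact_mod_cast h0
    linear_combination 5 * this

end Converse

/-! ### §7 The registered stub `MordellWeilE7` and the child `CertB3E7` BY NAME from `hQ`, `hQ5` -/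

/-- **`MordellWeilE7` (registered stub of stmt-Langlands-23416; `hE49` of `certB3E7`) — type VERBATIM —
from the two `ℚ`-point-list inputs `hQ` (`49a4(ℚ) ≅ ℤ/2`) and `hQ5` (its `5`-twist, conductor
`1225`, `≅ ℤ/2`)**, by `mordellWeilE7_of_fixedPoints ∘ fixedPointsW_of_ratPoints`.  CONDITIONAL on
the two named inputs. [cite: FreitasLeHungSiksek2015, Lemma 4.2 (arXiv:1310.7088 p. 28)] -/
theorem mordellWeilE7_of_ratPoints
    (hQ : ∀ X Y : ℚ, Y ^ 2 = X ^ 3 + 294 * X ^ 2 - 343 * X → X = 0)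
    (hQ5 : ∀ X Y : ℚ, Y ^ 2 = X ^ 3 + 1470 * X ^ 2 - 8575 * X → X = 0) :
    ∀ (K : Type) [Field K] [NumberField K], Module.finrank ℚ K = 4 → ∀ r : K, r ^ 2 = 5 →
        ∀ σ : K →+* K, σ r = r → σ ≠ RingHom.id K →
          ∀ x y : K, y ^ 2 = 7 * (16 * x ^ 4 + 68 * x ^ 3 + 111 * x ^ 2 + 62 * x + 11) → (σ x = x ∨ (12 * x + 5) * σ x = -(5 * x + 2)) :=
  mordellWeilE7_of_fixedPoints (fixedPointsW_of_ratPoints hQ hQ5)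

/-- **`CertB3E7` (stmt-Langlands-23416, sheet 4.5) BY NAME modulo {`ModelIdentificationB3E7Inf`,
`hQ`, `hQ5`}**: eng-7 g4's census-free `certB3E7_of_modelIdentificationInf_of_mordellWeil` (p675221)
with its Mordell–Weil input supplied by `mordellWeilE7_of_ratPoints`.  The sheet then rests on ONE
model identification (FLS Lemma 4.2 + `Ψ₃`, chart at infinity included) and TWO rank-`0` facts over
`ℚ` (Cremona `49a4`, and its `5`-twist of conductor `1225`).  CONDITIONAL; «a certified finite datum
is not a modularity statement»; nothing here proves modularity of a new class.
[cite: FreitasLeHungSiksek2015, Lemma 4.2 (arXiv:1310.7088 p. 28)] -/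
theorem certB3E7_of_modelIdentificationInf_of_ratPoints
    (hK1inf : ∀ (K : Type) [Field K] [NumberField K], Module.finrank ℚ K = 4 → (∃ r : K, r ^ 2 = 5) →
        ∀ E : WeierstrassCurve (NumberField.RingOfIntegers K), E.Δ ≠ 0 →
          (∃ ρ : Literature.NumberTheory.GaloisRepresentations.FramedGaloisRep K (ZMod 3) 2, (∃ e : (E.baseChange K).geomTorsion ((3 : ℕ) : ℤ) ≃+ (Fin 2 → ZMod 3), ∀ (σ : Field.absoluteGaloisGroup K) (P : (E.baseChange K).geomTorsion ((3 : ℕ) : ℤ)), e (σ • P) = ((ρ σ : GL (Fin 2) (ZMod 3)) : Matrix (Fin 2) (Fin 2) (ZMod 3)) *ᵥ (e P)) ∧ ((∀ σ : Field.absoluteGaloisGroup K, (((ρ σ : GL (Fin 2) (ZMod 3)) : Matrix (Fin 2) (Fin 2) (ZMod 3)) 1 0 = 0)))) →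
          (∃ ρ : Literature.NumberTheory.GaloisRepresentations.FramedGaloisRep K (ZMod 7) 2, (∃ e : (E.baseChange K).geomTorsion ((7 : ℕ) : ℤ) ≃+ (Fin 2 → ZMod 7), ∀ (σ : Field.absoluteGaloisGroup K) (P : (E.baseChange K).geomTorsion ((7 : ℕ) : ℤ)), e (σ • P) = ((ρ σ : GL (Fin 2) (ZMod 7)) : Matrix (Fin 2) (Fin 2) (ZMod 7)) *ᵥ (e P)) ∧ ((∀ σ : Field.absoluteGaloisGroup K, (ρ σ : GL (Fin 2) (ZMod 7)) ∈ Subgroup.closure ({(⟨!![0, 5; 3, 0], !![0, 5; 3, 0], by decide, by decide⟩ : GL (Fin 2) (ZMod 7)), (⟨!![5, 0; 3, 2], !![3, 0; 6, 4], by decide, by decide⟩ : GL (Fin 2) (ZMod 7))} : Set (GL (Fin 2) (ZMod 7)))))) →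
          ((E.baseChange K).c₄ ^ 3 = 1728 * (E.baseChange K).Δ ∨
           (∃ x₁ y₁ x₂ y₂ : K, y₁ ^ 2 = 7 * (16 * x₁ ^ 4 + 68 * x₁ ^ 3 + 111 * x₁ ^ 2 + 62 * x₁ + 11) ∧ y₂ ^ 2 = 7 * (16 * x₂ ^ 4 + 68 * x₂ ^ 3 + 111 * x₂ ^ 2 + 62 * x₂ + 11) ∧
            ((x₁ ^ 3 + x₁ ^ 2 - 2 * x₁ - 1) ^ 7) ≠ 0 ∧
            (E.baseChange K).c₄ ^ 3 * ((x₁ ^ 3 + x₁ ^ 2 - 2 * x₁ - 1) ^ 7) = ((3 * x₁ + 1) ^ 3 * (4 * x₁ ^ 2 + 5 * x₁ + 2) ^ 3 * (x₁ ^ 2 + 3 * x₁ + 4) ^ 3 * (x₁ ^ 2 + 10 * x₁ + 4) ^ 3) * (E.baseChange K).Δ ∧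
            ((3 * x₂ ^ 2 + 6 * x₂ + 2) ^ 2 * x₁ ^ 4 + (36 * x₂ ^ 4 + 125 * x₂ ^ 3 + 138 * x₂ ^ 2 + 60 * x₂ + 9) * x₁ ^ 3 + (48 * x₂ ^ 4 + 138 * x₂ ^ 3 + 111 * x₂ ^ 2 + 33 * x₂ + 3) * x₁ ^ 2 + (24 * x₂ ^ 4 + 60 * x₂ ^ 3 + 33 * x₂ ^ 2 + 5 * x₂) * x₁ + (4 * x₂ ^ 4 + 9 * x₂ ^ 3 + 3 * x₂ ^ 2)) = 0) ∨
           (∃ x₁ y₁ z : K, y₁ ^ 2 = 7 * (16 * x₁ ^ 4 + 68 * x₁ ^ 3 + 111 * x₁ ^ 2 + 62 * x₁ + 11) ∧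
            ((x₁ ^ 3 + x₁ ^ 2 - 2 * x₁ - 1) ^ 7) ≠ 0 ∧
            (E.baseChange K).c₄ ^ 3 * ((x₁ ^ 3 + x₁ ^ 2 - 2 * x₁ - 1) ^ 7) = ((3 * x₁ + 1) ^ 3 * (4 * x₁ ^ 2 + 5 * x₁ + 2) ^ 3 * (x₁ ^ 2 + 3 * x₁ + 4) ^ 3 * (x₁ ^ 2 + 10 * x₁ + 4) ^ 3) * (E.baseChange K).Δ ∧
            (3 * x₁ ^ 2 + 6 * x₁ + 2) ^ 2 = 0 ∧ z ^ 2 = 7)))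
    (hQ : ∀ X Y : ℚ, Y ^ 2 = X ^ 3 + 294 * X ^ 2 - 343 * X → X = 0)
    (hQ5 : ∀ X Y : ℚ, Y ^ 2 = X ^ 3 + 1470 * X ^ 2 - 8575 * X → X = 0) :
    CertB3E7 :=
  certB3E7_of_modelIdentificationInf_of_mordellWeil hK1inf (mordellWeilE7_of_ratPoints hQ hQ5)

/-! ### §8 Anchors: the twist `W⁵` is the conductor-`1225` curve `[1, −1, 1, −45555, 3753572]` -/

/-- `(u, r, s, t) = (2, −491, 1, 4)` takes `W⁵ = [0, 1470, 0, −8575, 0]` to the minimal model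
`[1, −1, 1, −45555, 3753572]` (conductor `1225 = 5²·7²`; PARI `ellglobalred`/`ellminimalmodel`,
kit j319940): the five `uⁱ·aᵢ' = …` identities of a Weierstrass change of variables, and
`T = (0, 0) ↦ (491/4, −495/8)` — PARI's torsion generator. [folklore] -/
theorem e7_W5_variableChange :
    (2 : ℚ) * 1 = 0 + 2 * 1 ∧
    (2 : ℚ) ^ 2 * (-1) = 1470 - 1 * 0 + 3 * (-491) - 1 ^ 2 ∧
    (2 : ℚ) ^ 3 * 1 = 0 + (-491) * 0 + 2 * 4 ∧
    (2 : ℚ) ^ 4 * (-45555) = -8575 - 1 * 0 + 2 * (-491) * 1470 - (4 + (-491) * 1) * 0 + 3 * (-491) ^ 2 - 2 * 1 * 4 ∧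
    (2 : ℚ) ^ 6 * 3753572 = 0 + (-491) * (-8575) + (-491) ^ 2 * 1470 + (-491) ^ 3 - 4 * 0 - 4 ^ 2 - (-491) * 4 * 0 ∧
    ((0 : ℚ) - (-491)) / 2 ^ 2 = 491 / 4 ∧ ((0 : ℚ) - 1 * 2 ^ 2 * (491 / 4) - 4) / 2 ^ 3 = -495 / 8 := by
  norm_num

/-- The torsion generators lie on the minimal models: `(99/4, −99/8)` on
`49a4 : y² + xy = x³ − x² − 1822x + 30393` and `(491/4, −495/8)` on
`y² + xy + y = x³ − x² − 45555x + 3753572`; and `(0,0)` is the only affine point of `W`, `W⁵` with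
`X = 0` (so `hQ`, `hQ5` say exactly «`E(ℚ) = {O, T}`»). [folklore] -/
theorem e7_W_W5_torsionPoints :
    ((-99 / 8 : ℚ) ^ 2 + (99 / 4) * (-99 / 8) = (99 / 4) ^ 3 - (99 / 4) ^ 2 - 1822 * (99 / 4) + 30393) ∧
    ((-495 / 8 : ℚ) ^ 2 + (491 / 4) * (-495 / 8) + (-495 / 8) =
        (491 / 4) ^ 3 - (491 / 4) ^ 2 - 45555 * (491 / 4) + 3753572) ∧
    (∀ Y : ℚ, Y ^ 2 = (0 : ℚ) ^ 3 + 294 * 0 ^ 2 - 343 * 0 → Y = 0) ∧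
    (∀ Y : ℚ, Y ^ 2 = (0 : ℚ) ^ 3 + 1470 * 0 ^ 2 - 8575 * 0 → Y = 0) := by
  refine ⟨by norm_num, by norm_num, fun Y h => ?_, fun Y h => ?_⟩ <;>
    exact pow_eq_zero_iff two_ne_zero |>.1 (by linear_combination h)

end Summit.Langlands.Langlands.Theorems.SqrtFiveQuarticCovers

end
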